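import Mathlib
import Literature.Analysis.FluidPDE.SelfSimilarEulerProfile
import Literature.Analysis.FluidPDE.NormalisedPressure
import Summits.NavierStokesRegularity.NavierStokesRegularity.Theorems.EulerZoomLiouvillePowerGaugeEulerLiouvillePressureBudgetPiLogAssembly
import HarnessLib

/-!
# Crux `EulerZoomLiouville.PowerGaugeEulerLiouville` (stmt-NavierStokesRegularity-19832), nsreg-p2 ROUND-58 plate t60-ΠLOG:
# THE SCALE-REPRESENTATION ASSEMBLY (five pieces S1–S5 + near-field log bound ⇒ `ScaleRepresentation ρ`, `0 < ρ ≤ 1`)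

Seat ns-ezl-w3 g9 (`--supports stmt-NavierStokesRegularity-19832 --as helper`; LEAD 19832 g16 KEY S58c-A, 2026-08-29 12:31Z).
Text = nsreg-p2 g45's `NsregP2.R58c.ScaleRepAssembly ρ` (`r58/Sketch58c.lean` sha16 c6fe466b7b48535d, §2) with every `def` δ-unfolded
VERBATIM (`NearFieldLog`, `Localise`, `RieszModConst`, `WeakPressureEquation`, `GradPressureL1Growth`, `LiouvilleModConst`, `SolvesPressurePoisson`,
`EBudget`, `VelocityBudget`, `ScaleRepresentation`; `E3` spelled out), so the plate closes BY NAME: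
`example (ρ) : NsregP2.R58c.ScaleRepAssembly ρ := PressureSeam.scaleRepAssembly ρ`.

Content (S, real analysis + a.e. bookkeeping, exactly 58c §2): for `0 < ρ ≤ 1` and a profile `(V, P)` with the two budgets,
S3 `Localise` gives the cutoff fields `w_R` (`= V` on `B_{2R}`, budgets `D₃R^{1−2ρ}`, `D₃R^{1−ρ}`); S4 `RieszModConst` gives the Riesz
pressure `Q` modulo constants with `|Q − c_R − p̃[w_R]| ≤ D₄R^{−2−2ρ}` a.e. on `B_R`; with PIECE (1′) `NearFieldLog` and the monotonicity
lemmas of the ΠLOG assembly (`mul_one_add_posLog_div_mono`, `posLog_scale_ratio_le`) this yields the mean-oscillation bound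
`∫_{B_R}|Q − c_R| ≤ D'·R^{2−2ρ}` (`1 + log R ≤ R`; exponent `m = 2 − 2ρ < 4`); S1 `WeakPressureEquation`, S2 `GradPressureL1Growth` and
S5 `LiouvilleModConst` then give `P = Q + κ` a.e.; finally `h_R := P − (κ + c_R) − p̃[w_R]` (pointwise) equals `Q − c_R − p̃[w_R]` a.e., so
`∫_{B_R}|h_R| ≤ max D₄ 0·|B_1|·R^{1−2ρ}`, and `h_R` is integrable on `B_R` (`P` continuous, `p̃[w_R]` integrable by (1′)).

* ★ `PressureSeam.scaleRepAssembly ρ` — `NsregP2.R58c.ScaleRepAssembly ρ` VERBATIM (defs δ-unfolded).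

HONEST FRAMING: instrument glue about HYPOTHETICAL profiles (the five analytic pieces are hypotheses here, keyed to their own hands);
nothing about the crux E (19832 OPEN) or NS regularity is proved; not E.  MODEL lattice only.
-/

noncomputable section

-- flat `Theorems/<Route><Decl>…` files of one crux share the namespace of the crux (tree convention)
set_option linter.dupNamespace false

open MeasureTheory Metric Filter Topology
open scoped ENNReal NNReal Laplacian

namespace Summit.NavierStokesRegularity.NavierStokesRegularity.Theorems.PowerGaugeEulerLiouville.PressureSeam

open Literature.Analysis.FluidPDE

/-- ★ **t60-ΠLOG, THE SCALE-REPRESENTATION ASSEMBLY** (= `NsregP2.R58c.ScaleRepAssembly ρ` VERBATIM, defs δ-unfolded): for `0 < ρ ≤ 1`,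
the near-field log bound (1′), the localisation S3, the Riesz pressure modulo constants S4, the weak pressure equation S1, the gradient
growth S2 and the Liouville uniqueness S5 imply Sketch58b's `ScaleRepresentation ρ` (`P = c_R + p̃[w_R] + h_R` on `B_R` with the budgets
and `∫_{B_R}|h_R| ≤ DR^{1−2ρ}`).  [nsreg-p2 R58 `r58/Sketch58c.lean` §2 `ScaleRepAssembly`] -/
theorem scaleRepAssembly (ρ : ℝ) :
    0 < ρ → ρ ≤ 1 →
    -- (1′) `NearFieldLog`
    (∃ C : ℝ, 0 < C ∧ ∀ R : ℝ, 1 ≤ R → ∀ w : EuclideanSpace ℝ (Fin 3) → EuclideanSpace ℝ (Fin 3),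
      ContDiff ℝ 2 w → HasCompactSupport w →
        IntegrableOn (normalisedPressure w) (ball (0 : EuclideanSpace ℝ (Fin 3)) R) volume ∧
        ∫ y in ball (0 : EuclideanSpace ℝ (Fin 3)) R, |normalisedPressure w y| ≤
          C * (∫ y, ‖w y‖ ^ 2) *
            (1 + Real.posLog (R ^ 2 * (∫ y, ‖fderiv ℝ w y‖ ^ 2) / ∫ y, ‖w y‖ ^ 2))) →
    -- S3 `Localise ρ`
    (∀ V : EuclideanSpace ℝ (Fin 3) → EuclideanSpace ℝ (Fin 3), ContDiff ℝ 2 V →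
      (∫⁻ y, ‖fderiv ℝ V y‖ₑ ^ 2 * ENNReal.ofReal (‖y‖ ^ (ρ - 1))) ≠ ⊤ →
      (∃ A : ℝ, ∀ R : ℝ, 1 ≤ R → ∫ y in ball (0 : EuclideanSpace ℝ (Fin 3)) R, ‖V y‖ ^ 2 ≤ A * R ^ (1 - 2 * ρ)) →
      -2 ≤ ρ → ρ ≤ 1 →
      ∃ D : ℝ, ∀ R : ℝ, 1 ≤ R → ∃ w : EuclideanSpace ℝ (Fin 3) → EuclideanSpace ℝ (Fin 3),
        ContDiff ℝ 2 w ∧ HasCompactSupport w ∧ (∀ y ∈ ball (0 : EuclideanSpace ℝ (Fin 3)) (2 * R), w y = V y) ∧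
        tsupport w ⊆ closedBall (0 : EuclideanSpace ℝ (Fin 3)) (3 * R) ∧ (∀ y, ‖w y‖ ≤ ‖V y‖) ∧
        (∫ y, ‖w y‖ ^ 2) ≤ D * R ^ (1 - 2 * ρ) ∧ (∫ y, ‖fderiv ℝ w y‖ ^ 2) ≤ D * R ^ (1 - ρ)) →
    -- S4 `RieszModConst ρ`
    (∀ V : EuclideanSpace ℝ (Fin 3) → EuclideanSpace ℝ (Fin 3), ContDiff ℝ 2 V →
      (∃ A : ℝ, ∀ R : ℝ, 1 ≤ R → ∫ y in ball (0 : EuclideanSpace ℝ (Fin 3)) R, ‖V y‖ ^ 2 ≤ A * R ^ (1 - 2 * ρ)) →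
      -3 / 2 < ρ →
      ∃ Q : EuclideanSpace ℝ (Fin 3) → ℝ, LocallyIntegrable Q volume ∧
        (∀ φ : EuclideanSpace ℝ (Fin 3) → ℝ, ContDiff ℝ (⊤ : ℕ∞) φ → HasCompactSupport φ →
          ∫ x, Q x * (Δ φ) x = -∫ x, fderiv ℝ (fderiv ℝ φ) x (V x) (V x)) ∧
        ∃ D : ℝ, ∀ R : ℝ, 1 ≤ R → ∀ w : EuclideanSpace ℝ (Fin 3) → EuclideanSpace ℝ (Fin 3),
          ContDiff ℝ 2 w → HasCompactSupport w →
          (∀ y ∈ ball (0 : EuclideanSpace ℝ (Fin 3)) (2 * R), w y = V y) → (∀ y, ‖w y‖ ≤ ‖V y‖) →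
          ∃ c : ℝ, ∀ᵐ x ∂(volume.restrict (ball (0 : EuclideanSpace ℝ (Fin 3)) R)),
            |Q x - c - normalisedPressure w x| ≤ D * R ^ (-2 - 2 * ρ)) →
    -- S1 `WeakPressureEquation`
    (∀ (γ : ℝ) (V : EuclideanSpace ℝ (Fin 3) → EuclideanSpace ℝ (Fin 3)) (P : EuclideanSpace ℝ (Fin 3) → ℝ),
      IsSelfSimilarEulerProfile γ 0 V P →
        ∀ φ : EuclideanSpace ℝ (Fin 3) → ℝ, ContDiff ℝ (⊤ : ℕ∞) φ → HasCompactSupport φ →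
          ∫ x, P x * (Δ φ) x = -∫ x, fderiv ℝ (fderiv ℝ φ) x (V x) (V x)) →
    -- S2 `GradPressureL1Growth ρ`
    (∀ (V : EuclideanSpace ℝ (Fin 3) → EuclideanSpace ℝ (Fin 3)) (P : EuclideanSpace ℝ (Fin 3) → ℝ),
      IsSelfSimilarEulerProfile (1 / (2 + ρ)) 0 V P →
        (∫⁻ y, ‖fderiv ℝ V y‖ₑ ^ 2 * ENNReal.ofReal (‖y‖ ^ (ρ - 1))) ≠ ⊤ →
        (∃ A : ℝ, ∀ R : ℝ, 1 ≤ R → ∫ y in ball (0 : EuclideanSpace ℝ (Fin 3)) R, ‖V y‖ ^ 2 ≤ A * R ^ (1 - 2 * ρ)) →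
        ρ ≤ 1 →
        ∃ D : ℝ, ∀ R : ℝ, 1 ≤ R →
          ∫ y in ball (0 : EuclideanSpace ℝ (Fin 3)) R, ‖gradient P y‖ ≤ D * R ^ (3 - ρ / 2)) →
    -- S5 `LiouvilleModConst ρ`
    (∀ (V : EuclideanSpace ℝ (Fin 3) → EuclideanSpace ℝ (Fin 3)) (P Q : EuclideanSpace ℝ (Fin 3) → ℝ),
      0 < ρ → ρ < 2 → ContDiff ℝ 1 P → LocallyIntegrable Q volume →
        (∀ φ : EuclideanSpace ℝ (Fin 3) → ℝ, ContDiff ℝ (⊤ : ℕ∞) φ → HasCompactSupport φ →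
          ∫ x, P x * (Δ φ) x = -∫ x, fderiv ℝ (fderiv ℝ φ) x (V x) (V x)) →
        (∀ φ : EuclideanSpace ℝ (Fin 3) → ℝ, ContDiff ℝ (⊤ : ℕ∞) φ → HasCompactSupport φ →
          ∫ x, Q x * (Δ φ) x = -∫ x, fderiv ℝ (fderiv ℝ φ) x (V x) (V x)) →
        (∃ D : ℝ, ∀ R : ℝ, 1 ≤ R →
          ∫ y in ball (0 : EuclideanSpace ℝ (Fin 3)) R, ‖gradient P y‖ ≤ D * R ^ (3 - ρ / 2)) →
        (∃ (D m : ℝ), m < 4 ∧ ∀ R : ℝ, 1 ≤ R → ∃ c : ℝ,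
          ∫ y in ball (0 : EuclideanSpace ℝ (Fin 3)) R, |Q y - c| ≤ D * R ^ m) →
        ∃ κ : ℝ, ∀ᵐ x ∂volume, P x = Q x + κ) →
    -- ⟹ `ScaleRepresentation ρ`
    ∀ (V : EuclideanSpace ℝ (Fin 3) → EuclideanSpace ℝ (Fin 3)) (P : EuclideanSpace ℝ (Fin 3) → ℝ),
      IsSelfSimilarEulerProfile (1 / (2 + ρ)) 0 V P →
        (∫⁻ y, ‖fderiv ℝ V y‖ₑ ^ 2 * ENNReal.ofReal (‖y‖ ^ (ρ - 1))) ≠ ⊤ →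
        (∃ A : ℝ, ∀ R : ℝ, 1 ≤ R →
          ∫ y in ball (0 : EuclideanSpace ℝ (Fin 3)) R, ‖V y‖ ^ 2 ≤ A * R ^ (1 - 2 * ρ)) →
        ∃ D : ℝ, ∀ R : ℝ, 1 ≤ R →
          ∃ (c : ℝ) (w : EuclideanSpace ℝ (Fin 3) → EuclideanSpace ℝ (Fin 3)) (h : EuclideanSpace ℝ (Fin 3) → ℝ),
            ContDiff ℝ 2 w ∧ HasCompactSupport w ∧
            (∀ y ∈ ball (0 : EuclideanSpace ℝ (Fin 3)) (3 * R / 2), w y = V y) ∧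
            (∫ y, ‖w y‖ ^ 2) ≤ D * R ^ (1 - 2 * ρ) ∧
            (∫ y, ‖fderiv ℝ w y‖ ^ 2) ≤ D * R ^ (1 - ρ) ∧
            IntegrableOn h (ball (0 : EuclideanSpace ℝ (Fin 3)) R) volume ∧
            (∫ y in ball (0 : EuclideanSpace ℝ (Fin 3)) R, |h y|) ≤ D * R ^ (1 - 2 * ρ) ∧
            ∀ y ∈ ball (0 : EuclideanSpace ℝ (Fin 3)) R, P y = c + normalisedPressure w y + h y := by
  intro hρ0 hρ1 h1 h3 h4 hS1 hS2 hS5 V P hprof hE hA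
  -- the data of the profile
  have hV2 : ContDiff ℝ 2 V := hprof.contDiff_velocity
  have hP1 : ContDiff ℝ 1 P := hprof.contDiff_pressure
  have hPc : Continuous P := hP1.continuous
  -- (1′)
  obtain ⟨C, hC0, hC⟩ := h1
  -- S3: the cutoff fields
  obtain ⟨D₃, hD₃⟩ := h3 V hV2 hE hA (by linarith) hρ1
  -- S4: the Riesz pressure modulo constants
  obtain ⟨Q, hQli, hQpoisson, D₄, hD₄⟩ := h4 V hV2 hA (by linarith)
  -- S1, S2
  have hPpoisson := hS1 (1 / (2 + ρ)) V P hprof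
  obtain ⟨D₂, hD₂⟩ := hS2 V P hprof hE hA hρ1
  -- constants
  set D₃' : ℝ := max D₃ 1 with hD₃'_def
  have hD₃D₃' : D₃ ≤ D₃' := le_max_left _ _
  have hD₃'0 : 0 < D₃' := one_pos.trans_le (le_max_right _ _)
  set D₄' : ℝ := max D₄ 0 with hD₄'_def
  have hD₄D₄' : D₄ ≤ D₄' := le_max_left _ _
  have hD₄'0 : 0 ≤ D₄' := le_max_right _ _
  set v₁ : ℝ := (volume (ball (0 : EuclideanSpace ℝ (Fin 3)) 1)).toReal with hv₁_def
  have hv₁0 : 0 ≤ v₁ := ENNReal.toReal_nonneg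
  have hvol : ∀ {R : ℝ}, 0 ≤ R → (volume (ball (0 : EuclideanSpace ℝ (Fin 3)) R)).toReal = R ^ 3 * v₁ := by
    intro R hR
    rw [Measure.addHaar_ball volume (0 : EuclideanSpace ℝ (Fin 3)) hR, ENNReal.toReal_mul,
      ENNReal.toReal_ofReal (pow_nonneg hR _), finrank_euclideanSpace_fin]
  -- per-scale data: the cutoff `w_R`, the constant `c_R`, the a.e. bound, the near-field bound
  have hscale : ∀ R : ℝ, 1 ≤ R → ∃ (w : EuclideanSpace ℝ (Fin 3) → EuclideanSpace ℝ (Fin 3)) (c : ℝ),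
      ContDiff ℝ 2 w ∧ HasCompactSupport w ∧ (∀ y ∈ ball (0 : EuclideanSpace ℝ (Fin 3)) (2 * R), w y = V y) ∧
      (∫ y, ‖w y‖ ^ 2) ≤ D₃' * R ^ (1 - 2 * ρ) ∧ (∫ y, ‖fderiv ℝ w y‖ ^ 2) ≤ D₃' * R ^ (1 - ρ) ∧
      (∀ᵐ x ∂(volume.restrict (ball (0 : EuclideanSpace ℝ (Fin 3)) R)),
        |Q x - c - normalisedPressure w x| ≤ D₄' * R ^ (-2 - 2 * ρ)) ∧
      IntegrableOn (normalisedPressure w) (ball (0 : EuclideanSpace ℝ (Fin 3)) R) volume ∧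
      (∫ y in ball (0 : EuclideanSpace ℝ (Fin 3)) R, |normalisedPressure w y| ≤
        C * D₃' * (1 + |2 + ρ|) * (R ^ (1 - 2 * ρ) * (1 + Real.log R))) := by
    intro R hR
    have hR0 : 0 < R := by linarith
    have hρa : 0 < R ^ (1 - 2 * ρ) := Real.rpow_pos_of_pos hR0 _
    have hρb : 0 < R ^ (1 - ρ) := Real.rpow_pos_of_pos hR0 _
    have hρc : 0 < R ^ (-2 - 2 * ρ) := Real.rpow_pos_of_pos hR0 _
    obtain ⟨w, hw2, hwc, hwV, -, hwle, hm, he⟩ := hD₃ R hR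
    obtain ⟨c, hc⟩ := hD₄ R hR w hw2 hwc hwV hwle
    obtain ⟨hpint, hpL1⟩ := hC R hR w hw2 hwc
    refine ⟨w, c, hw2, hwc, hwV, hm.trans (mul_le_mul_of_nonneg_right hD₃D₃' hρa.le),
      he.trans (mul_le_mul_of_nonneg_right hD₃D₃' hρb.le), ?_, hpint, ?_⟩
    · filter_upwards [hc] with x hx
      exact hx.trans (mul_le_mul_of_nonneg_right hD₄D₄' hρc.le)
    · -- the near field, by the monotonicity of `m ↦ m(1 + log⁺(K/m))` (as in the ΠLOG assembly)
      set m : ℝ := ∫ y, ‖w y‖ ^ 2 with hm_def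
      set e : ℝ := ∫ y, ‖fderiv ℝ w y‖ ^ 2 with he_def
      have hm0 : 0 ≤ m := integral_nonneg fun _ => by positivity
      have he0 : 0 ≤ e := integral_nonneg fun _ => by positivity
      set M : ℝ := D₃' * R ^ (1 - 2 * ρ) with hM_def
      have hM0 : 0 < M := mul_pos hD₃'0 hρa
      have hmM : m ≤ M := hm.trans (mul_le_mul_of_nonneg_right hD₃D₃' hρa.le)
      have heM : e ≤ D₃' * R ^ (1 - ρ) := he.trans (mul_le_mul_of_nonneg_right hD₃D₃' hρb.le)
      have hlogR : 0 ≤ Real.log R := Real.log_nonneg hR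
      have key1 : m * (1 + Real.posLog (R ^ 2 * e / m)) ≤ M * (1 + Real.posLog (R ^ 2 * e / M)) :=
        mul_one_add_posLog_div_mono (by positivity) hm0 hmM
      have key2 : Real.posLog (R ^ 2 * e / M) ≤ |2 + ρ| * Real.log R := by
        refine le_trans (Real.posLog_le_posLog (by positivity) ?_) (posLog_scale_ratio_le (ρ := ρ) hR hD₃'0)
        exact div_le_div_of_nonneg_right (mul_le_mul_of_nonneg_left heM (by positivity)) hM0.le
      calc ∫ y in ball (0 : EuclideanSpace ℝ (Fin 3)) R, |normalisedPressure w y|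
          ≤ C * m * (1 + Real.posLog (R ^ 2 * e / m)) := hpL1
        _ = C * (m * (1 + Real.posLog (R ^ 2 * e / m))) := by ring
        _ ≤ C * (M * (1 + |2 + ρ| * Real.log R)) := by
            refine mul_le_mul_of_nonneg_left (key1.trans ?_) hC0.le
            exact mul_le_mul_of_nonneg_left (by linarith) hM0.le
        _ ≤ C * (M * ((1 + |2 + ρ|) * (1 + Real.log R))) := by
            refine mul_le_mul_of_nonneg_left (mul_le_mul_of_nonneg_left ?_ hM0.le) hC0.le
            nlinarith [abs_nonneg (2 + ρ), hlogR]
        _ = C * D₃' * (1 + |2 + ρ|) * (R ^ (1 - 2 * ρ) * (1 + Real.log R)) := by rw [hM_def]; ring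
  choose! wR cR hwR using hscale
  -- the mean oscillation of `Q`: exponent `m = 2 − 2ρ < 4`
  have hosc : ∃ (D m : ℝ), m < 4 ∧ ∀ R : ℝ, 1 ≤ R → ∃ c : ℝ,
      ∫ y in ball (0 : EuclideanSpace ℝ (Fin 3)) R, |Q y - c| ≤ D * R ^ m := by
    refine ⟨D₄' * v₁ + C * D₃' * (1 + |2 + ρ|), 2 - 2 * ρ, by linarith, fun R hR => ⟨cR R, ?_⟩⟩
    obtain ⟨hw2, hwc, hwV, hm, he, hae, hpint, hpL1⟩ := hwR R hR
    have hR0 : 0 < R := by linarith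
    have hρa : 0 < R ^ (1 - 2 * ρ) := Real.rpow_pos_of_pos hR0 _
    have hρc : 0 ≤ R ^ (-2 - 2 * ρ) := (Real.rpow_pos_of_pos hR0 _).le
    -- integrable majorant `D₄' R^{−2−2ρ} + |p̃[w_R]|` on the ball
    have hconst : IntegrableOn (fun _ : EuclideanSpace ℝ (Fin 3) => D₄' * R ^ (-2 - 2 * ρ))
        (ball (0 : EuclideanSpace ℝ (Fin 3)) R) volume :=
      (continuous_const.continuousOn.integrableOn_compact (isCompact_closedBall (0 : EuclideanSpace ℝ (Fin 3)) R)).mono_set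
        ball_subset_closedBall
    have hmaj : IntegrableOn (fun x => D₄' * R ^ (-2 - 2 * ρ) + |normalisedPressure (wR R) x|)
        (ball (0 : EuclideanSpace ℝ (Fin 3)) R) volume := hconst.add hpint.abs
    have step : ∫ y in ball (0 : EuclideanSpace ℝ (Fin 3)) R, |Q y - cR R| ≤
        ∫ y in ball (0 : EuclideanSpace ℝ (Fin 3)) R, (D₄' * R ^ (-2 - 2 * ρ) + |normalisedPressure (wR R) y|) := by
      refine integral_mono_of_nonneg (ae_of_all _ fun y => abs_nonneg _) hmaj ?_
      filter_upwards [hae] with x hx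
      have := abs_sub_le (Q x - cR R) (normalisedPressure (wR R) x) 0
      simp only [sub_zero] at this
      linarith [abs_sub_comm (Q x - cR R) (normalisedPressure (wR R) x)]
    rw [integral_add hconst hpint.abs, setIntegral_const, measureReal_def, hvol hR0.le, smul_eq_mul] at step
    -- exponent bookkeeping
    have hpow1 : R ^ 3 * v₁ * (D₄' * R ^ (-2 - 2 * ρ)) = D₄' * v₁ * R ^ (1 - 2 * ρ) := by
      have : R ^ (1 - 2 * ρ) = R ^ (3 : ℝ) * R ^ (-2 - 2 * ρ) := by
        rw [← Real.rpow_add hR0]; congr 1; ring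
      rw [this, ← Real.rpow_natCast R 3]
      push_cast
      ring
    have hpow2 : R ^ (1 - 2 * ρ) ≤ R ^ (2 - 2 * ρ) := Real.rpow_le_rpow_of_exponent_le hR (by linarith)
    have hlogle : 1 + Real.log R ≤ R := by
      have := Real.add_one_le_exp (Real.log R)
      rw [Real.exp_log hR0] at this
      linarith
    have hpow3 : R ^ (1 - 2 * ρ) * (1 + Real.log R) ≤ R ^ (2 - 2 * ρ) := by
      calc R ^ (1 - 2 * ρ) * (1 + Real.log R) ≤ R ^ (1 - 2 * ρ) * R :=
            mul_le_mul_of_nonneg_left hlogle hρa.le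
        _ = R ^ (2 - 2 * ρ) := by
            rw [← Real.rpow_add_one hR0.ne']; congr 1; ring
    have hCD : 0 ≤ C * D₃' * (1 + |2 + ρ|) := by positivity
    calc ∫ y in ball (0 : EuclideanSpace ℝ (Fin 3)) R, |Q y - cR R|
        ≤ R ^ 3 * v₁ * (D₄' * R ^ (-2 - 2 * ρ)) + ∫ y in ball (0 : EuclideanSpace ℝ (Fin 3)) R, |normalisedPressure (wR R) y| := step
      _ ≤ D₄' * v₁ * R ^ (1 - 2 * ρ) + C * D₃' * (1 + |2 + ρ|) * (R ^ (1 - 2 * ρ) * (1 + Real.log R)) := by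
          rw [hpow1]; exact add_le_add le_rfl hpL1
      _ ≤ D₄' * v₁ * R ^ (2 - 2 * ρ) + C * D₃' * (1 + |2 + ρ|) * R ^ (2 - 2 * ρ) :=
          add_le_add (mul_le_mul_of_nonneg_left hpow2 (by positivity)) (mul_le_mul_of_nonneg_left hpow3 hCD)
      _ = (D₄' * v₁ + C * D₃' * (1 + |2 + ρ|)) * R ^ (2 - 2 * ρ) := by ring
  -- S5: `P = Q + κ` a.e.
  obtain ⟨κ, hκ⟩ := hS5 V P Q hρ0 (by linarith) hP1 hQli hPpoisson hQpoisson ⟨D₂, hD₂⟩ hosc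
  -- the representation
  refine ⟨max D₃' (D₄' * v₁), fun R hR => ?_⟩
  obtain ⟨hw2, hwc, hwV, hm, he, hae, hpint, -⟩ := hwR R hR
  have hR0 : 0 < R := by linarith
  have hρa : 0 ≤ R ^ (1 - 2 * ρ) := (Real.rpow_pos_of_pos hR0 _).le
  have hρb : 0 ≤ R ^ (1 - ρ) := (Real.rpow_pos_of_pos hR0 _).le
  refine ⟨κ + cR R, wR R, fun y => P y - (κ + cR R) - normalisedPressure (wR R) y, hw2, hwc, ?_, ?_, ?_, ?_, ?_, ?_⟩
  · -- `w_R = V` on `B_{3R/2} ⊆ B_{2R}`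
    intro y hy
    exact hwV y (ball_subset_ball (by linarith) hy)
  · exact hm.trans (mul_le_mul_of_nonneg_right (le_max_left _ _) hρa)
  · exact he.trans (mul_le_mul_of_nonneg_right (le_max_left _ _) hρb)
  · -- integrability of `h_R` on the ball
    have hPint : IntegrableOn P (ball (0 : EuclideanSpace ℝ (Fin 3)) R) volume :=
      (hPc.continuousOn.integrableOn_compact (isCompact_closedBall (0 : EuclideanSpace ℝ (Fin 3)) R)).mono_set
        ball_subset_closedBall
    have hcint : IntegrableOn (fun _ : EuclideanSpace ℝ (Fin 3) => κ + cR R) (ball (0 : EuclideanSpace ℝ (Fin 3)) R) volume :=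
      (continuous_const.continuousOn.integrableOn_compact (isCompact_closedBall (0 : EuclideanSpace ℝ (Fin 3)) R)).mono_set
        ball_subset_closedBall
    exact (hPint.sub hcint).sub hpint
  · -- `∫_{B_R}|h_R| ≤ D₄'|B_1| R^{1−2ρ}`: `h_R = Q − c_R − p̃[w_R]` a.e.
    have hconst : IntegrableOn (fun _ : EuclideanSpace ℝ (Fin 3) => D₄' * R ^ (-2 - 2 * ρ))
        (ball (0 : EuclideanSpace ℝ (Fin 3)) R) volume :=
      (continuous_const.continuousOn.integrableOn_compact (isCompact_closedBall (0 : EuclideanSpace ℝ (Fin 3)) R)).mono_set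
        ball_subset_closedBall
    have step : ∫ y in ball (0 : EuclideanSpace ℝ (Fin 3)) R, |P y - (κ + cR R) - normalisedPressure (wR R) y| ≤
        ∫ y in ball (0 : EuclideanSpace ℝ (Fin 3)) R, D₄' * R ^ (-2 - 2 * ρ) := by
      refine integral_mono_of_nonneg (ae_of_all _ fun y => abs_nonneg _) hconst ?_
      filter_upwards [hae, ae_restrict_of_ae (s := ball (0 : EuclideanSpace ℝ (Fin 3)) R) hκ] with x hx hPQ
      rw [hPQ, show Q x + κ - (κ + cR R) - normalisedPressure (wR R) x = Q x - cR R - normalisedPressure (wR R) x by ring]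
      exact hx
    rw [setIntegral_const, measureReal_def, hvol hR0.le, smul_eq_mul] at step
    have hpow1 : R ^ 3 * v₁ * (D₄' * R ^ (-2 - 2 * ρ)) = D₄' * v₁ * R ^ (1 - 2 * ρ) := by
      have : R ^ (1 - 2 * ρ) = R ^ (3 : ℝ) * R ^ (-2 - 2 * ρ) := by
        rw [← Real.rpow_add hR0]; congr 1; ring
      rw [this, ← Real.rpow_natCast R 3]
      push_cast
      ring
    rw [hpow1] at step
    exact step.trans (mul_le_mul_of_nonneg_right (le_max_right _ _) hρa)
  · intro y _
    ring

end Summit.NavierStokesRegularity.NavierStokesRegularity.Theorems.PowerGaugeEulerLiouville.PressureSeam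

end
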